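import Summits.RiemannHypothesis.RiemannHypothesis.Theorems.RuelleBandExactFirstBandStubHeatSummable
import Summits.RiemannHypothesis.RiemannHypothesis.Theorems.RuelleBandExactFirstBandStubExactHeatPD
import Summits.RiemannHypothesis.RiemannHypothesis.Theorems.RuelleBandExactFirstBandStubHeatConeIff
import Summits.RiemannHypothesis.RiemannHypothesis.Theorems.RuelleBandExactFirstBandStubCutoffMellin
import Summits.RiemannHypothesis.RiemannHypothesis.Theorems.RuelleBandExactFirstBandStubZeroSideLimit
import Summits.RiemannHypothesis.RiemannHypothesis.Theorems.RuelleBandExactFirstBandStubArchLimit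
import Summits.RiemannHypothesis.RiemannHypothesis.Theorems.RuelleBandExactFirstBandStubPrimeLimit
import Summits.RiemannHypothesis.RiemannHypothesis.Theorems.RuelleBandExactFirstBandStubGaussDecay
import Summits.RiemannHypothesis.RiemannHypothesis.Theorems.RuelleBandExactFirstBandStubGaussMellin
import Summits.RiemannHypothesis.RiemannHypothesis.Theorems.ExactFirstBand.Negative.Reformulations
import Literature.NumberTheory.LFunctions.WeilExplicitFormulaProofs
import Literature.NumberTheory.LFunctions.WeilCriterionProofs
import Mathlib.Analysis.Calculus.BumpFunction.InnerProduct
import HarnessLib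

/-!
# The Gaussian explicit formula and the prime-side form of the heat-cone bet

Line `Sketch` (heat cone) for the crux `Summit.RiemannHypothesis.RiemannHypothesis.Theses.RuelleBand.ExactFirstBand`
(item stmt-RiemannHypothesis-2061), cycle 2 — the GLUE of the reshaped skeleton, landed as supporting theorems:

* `explicit_formula_of_decay` — the Guinand–Weil explicit formula `Σ_ρ m(ρ) ĝ(ρ) = W(g)` (absolutely convergent
  zero side) for SMOOTH test functions with `∫(|g|+|g'|+|g''|)e^{|t|/2} < ∞` and `|g(t)| ≤ Ce^{-|t|}` — the
  tree's theorem for compactly supported tests (`explicit_formula_holds`, Bombieri 2000 Thm 2) extended by cut-off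
  approximation `g_R = χ(·/R)·g` (stubs `stub_cutoffMellin`, `stub_zeroSideLimit`, `stub_archLimit`,
  `stub_primeLimit`); `hasWeilZeroSide_of_decay` is the same in the tree's symmetric-limit spelling;
* `gauss_explicit_formula`, `heatTrace_eq_gauss` — the Gaussian case `g_u(t) = (4πu)^{-1/2}e^{-t²/(4u)}`:
  `Σ_ρ m(ρ) e^{-uρ(1-ρ)} = e^{-u/4} · W(g_u)` for `u > 0` (stubs `stub_gaussDecay`, `stub_gaussMellin`;
  numerically confirmed beforehand in the tree's normalisation, kit j014946);
* `heatPD_of_weilGaussPD`, `weilGaussPD_iff_exactFirstBand`, `weilGaussPD_iff_riemannHypothesis`,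
  `weilGaussPD_of_weilPositivity` — CALIBRATION of the line's prime-side bet "`u ↦ Re W(g_u)` is positive definite
  on `((0,∞),+)`" (Weil positivity on the Gaussian semigroup `g_u ⋆ g_v = g_{u+v}`): it is EXACTLY X (= RH in tree),
  and it follows from `WeilPositivity`.

References: E. Bombieri, Rend. Lincei (9) 11 (2000) §2 Thm 2; A. Weil (1952); H. Iwaniec–E. Kowalski Thm 5.12.
-/

set_option linter.dupNamespace false

noncomputable section

open Complex MeasureTheory Filter Set
open scoped BigOperators Topology ComplexConjugate ContDiff Real

namespace Summit.RiemannHypothesis.RiemannHypothesis.Theorems.RuelleBandExactFirstBand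

open Summit.RiemannHypothesis.RiemannHypothesis.Theses.RuelleBand
open Literature.NumberTheory.LFunctions

/-- **The Guinand–Weil explicit formula for smooth rapidly decaying test functions** (absolutely
convergent form): if `g` is smooth, `∫(|g|+|g'|+|g''|)e^{|t|/2} < ∞` and `|g(t)| ≤ Ce^{-|t|}`, then
`Σ_ρ m(ρ) ĝ(ρ)` converges absolutely over the non-trivial zeros and equals `W(g)`.  Cut-off approximation
of the tree's `explicit_formula_holds` (stubs `stub_cutoffMellin`, `stub_zeroSideLimit`, `stub_archLimit`,
`stub_primeLimit`). [cite: Bombieri2000Weil, §2 Thm 2] -/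
theorem explicit_formula_of_decay {g : ℝ → ℂ} (hg : ContDiff ℝ ∞ g)
    (h0 : Integrable (fun t : ℝ => ‖g t‖ * Real.exp (|t| / 2)))
    (h1 : Integrable (fun t : ℝ => ‖deriv g t‖ * Real.exp (|t| / 2)))
    (h2 : Integrable (fun t : ℝ => ‖deriv (deriv g) t‖ * Real.exp (|t| / 2)))
    (hdec : ∃ C : ℝ, ∀ t : ℝ, ‖g t‖ ≤ C * Real.exp (-|t|)) :
    Summable (fun ρ : ZetaZeros.riemannZetaNontrivialZeros =>
        ‖(riemannZetaZeroOrder (ρ : ℂ) : ℂ) * weilMellin g ρ‖) ∧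
      ∑' ρ : ZetaZeros.riemannZetaNontrivialZeros, (riemannZetaZeroOrder (ρ : ℂ) : ℂ) * weilMellin g ρ =
        weilFunctional g := by
  -- a fixed cut-off profile (`= 1` on `[-1,1]`, supported in `(-2,2)`), kept opaque
  obtain ⟨χ⟩ : Nonempty (ContDiffBump (0 : ℝ)) := ⟨⟨1, 2, one_pos, one_lt_two⟩⟩
  obtain ⟨hWT, ⟨D, hD⟩, hpt⟩ := stub_cutoffMellin χ g hg h0 h1 h2
  set gR : ℝ → ℝ → ℂ := fun R t => (χ (t / R) : ℂ) * g t with hgR_def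
  -- the explicit formula at each level `R > 0` (tree), in absolutely convergent form
  have hEF : ∀ R : ℝ, 0 < R →
      ∑' ρ : ZetaZeros.riemannZetaNontrivialZeros, (riemannZetaZeroOrder (ρ : ℂ) : ℂ) * weilMellin (gR R) ρ =
        weilFunctional (gR R) := fun R hR =>
    tendsto_nhds_unique (hasWeilZeroSide_tsum (summable_norm_zeroSide (hWT R hR)))
      (explicit_formula_holds (hWT R hR))
  -- the zero side
  have hstrip : ∀ ρ ∈ ZetaZeros.riemannZetaNontrivialZeros, |ρ.re - 1 / 2| ≤ 1 / 2 := fun ρ hρ =>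
    abs_le.2 ⟨by linarith [ZetaZeros.riemannZetaNontrivialZeros.re_pos hρ],
      by linarith [ZetaZeros.riemannZetaNontrivialZeros.re_lt_one hρ]⟩
  obtain ⟨hsum, hzero⟩ := stub_zeroSideLimit (fun R ρ => weilMellin (gR R) ρ) (weilMellin g) D
    (fun R hR ρ hρ => hD R hR ρ (hstrip ρ hρ)) (fun ρ hρ => hpt ρ (hstrip ρ hρ))
  -- the Weil side
  have hW : Tendsto (fun R => weilFunctional (gR R)) atTop (𝓝 (weilFunctional g)) := by
    have hp0 : Tendsto (fun R => weilMellin (gR R) 0) atTop (𝓝 (weilMellin g 0)) := hpt 0 (by norm_num)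
    have hp1 : Tendsto (fun R => weilMellin (gR R) 1) atTop (𝓝 (weilMellin g 1)) := hpt 1 (by norm_num)
    have hprime : Tendsto (fun R => weilPrimeTerm (gR R)) atTop (𝓝 (weilPrimeTerm g)) :=
      stub_primeLimit χ g hg.continuous hdec
    have harch : Tendsto (fun R => weilArchIntegral (gR R)) atTop (𝓝 (weilArchIntegral g)) := by
      refine stub_archLimit (fun R t => weilMellin (gR R) (1 / 2 + t * I))
        (fun t => weilMellin g (1 / 2 + t * I)) D ?_ ?_ ?_
      · intro R hR
        exact (continuous_weilMellin (hWT R (by linarith)).1.continuous (hWT R (by linarith)).2).comp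
          (by fun_prop)
      · intro R hR t
        have h := hD R hR (1 / 2 + t * I) (by simp)
        simpa using h
      · intro t
        exact hpt (1 / 2 + t * I) (by simp)
    have h0R : ∀ R : ℝ, gR R 0 = g 0 := fun R => by
      simp [hgR_def, χ.one_of_mem_closedBall (Metric.mem_closedBall_self χ.rIn_pos.le)]
    simp only [weilFunctional, weilPolarTerm, weilArchTerm, h0R]
    exact ((hp0.add hp1).sub hprime).add ((harch.const_mul _).sub tendsto_const_nhds)
  -- uniqueness of limits
  refine ⟨hsum, tendsto_nhds_unique hzero ?_⟩
  exact hW.congr' ((eventually_gt_atTop 0).mono fun R hR => (hEF R hR).symm)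

/-- **The Gaussian explicit formula (Mellin form)**: `Σ_ρ m(ρ) ĝ_u(ρ) = W(g_u)`, absolutely convergent. -/
theorem gauss_explicit_formula (u : ℝ) (hu : 0 < u) :
    Summable (fun ρ : ZetaZeros.riemannZetaNontrivialZeros =>
        ‖(riemannZetaZeroOrder (ρ : ℂ) : ℂ) *
          weilMellin (fun t : ℝ => ((Real.exp (-(t ^ 2) / (4 * u)) / Real.sqrt (4 * Real.pi * u) : ℝ) : ℂ)) ρ‖) ∧
      ∑' ρ : ZetaZeros.riemannZetaNontrivialZeros, (riemannZetaZeroOrder (ρ : ℂ) : ℂ) *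
          weilMellin (fun t : ℝ => ((Real.exp (-(t ^ 2) / (4 * u)) / Real.sqrt (4 * Real.pi * u) : ℝ) : ℂ)) ρ =
        weilFunctional
          (fun t : ℝ => ((Real.exp (-(t ^ 2) / (4 * u)) / Real.sqrt (4 * Real.pi * u) : ℝ) : ℂ)) := by
  obtain ⟨hC, h0, h1, h2, hdec⟩ := stub_gaussDecay u hu
  exact explicit_formula_of_decay hC h0 h1 h2 hdec

/-- **The Gaussian explicit formula (heat-trace form)**: for `u > 0`,
`Z(u) = Σ_ρ m(ρ) e^{-uρ(1-ρ)} = e^{-u/4} · W(g_u)` (disprover's `GaussianExplicitFormula`, kit j014946). -/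
theorem heatTrace_eq_gauss :
    ∀ u : ℝ, 0 < u →
      ∑' ρ : ZetaZeros.riemannZetaNontrivialZeros,
          (riemannZetaZeroOrder (ρ : ℂ) : ℂ) * cexp (-((u : ℂ) * ((ρ : ℂ) * (1 - (ρ : ℂ))))) =
        cexp (-(u : ℂ) / 4) *
          weilFunctional
            (fun t : ℝ => ((Real.exp (-(t ^ 2) / (4 * u)) / Real.sqrt (4 * Real.pi * u) : ℝ) : ℂ)) := by
  intro u hu
  rw [← (gauss_explicit_formula u hu).2, ← tsum_mul_left]
  refine tsum_congr fun ρ => ?_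
  rw [stub_gaussMellin u hu,
    show cexp (-(u : ℂ) / 4) * ((riemannZetaZeroOrder (ρ : ℂ) : ℂ) * cexp ((u : ℂ) * ((ρ : ℂ) - 1 / 2) ^ 2)) =
        (riemannZetaZeroOrder (ρ : ℂ) : ℂ) * (cexp (-(u : ℂ) / 4) * cexp ((u : ℂ) * ((ρ : ℂ) - 1 / 2) ^ 2)) by
      ring,
    ← Complex.exp_add]
  exact congrArg _ (congrArg _ (by ring))

/-- **Heat-cone positivity from the prime-side bet** (cycle 1's `stub_heatPD`, DERIVED from the bet):
`Re Z(s_a+s_b) = e^{-s_a/4} e^{-s_b/4} Re W(g_{s_a+s_b})`, so the heat form with coefficients `c_a` is the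
Weil–Gauss form with coefficients `c_a e^{-s_a/4}`. -/
theorem heatPD_of_weilGaussPD
    (hbet : ∀ (n : ℕ) (s c : Fin n → ℝ), (∀ a, 0 < s a) →
      0 ≤ ∑ a, ∑ b, c a * c b *
        (weilFunctional (fun t : ℝ =>
          ((Real.exp (-(t ^ 2) / (4 * (s a + s b))) / Real.sqrt (4 * Real.pi * (s a + s b)) : ℝ) : ℂ))).re) :
    ∀ (n : ℕ) (s c : Fin n → ℝ), (∀ a, 0 < s a) →
      0 ≤ ∑ a, ∑ b, c a * c b *
        (∑' ρ : ZetaZeros.riemannZetaNontrivialZeros,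
          (riemannZetaZeroOrder (ρ : ℂ) : ℂ) * cexp (-(((s a + s b : ℝ) : ℂ) * ((ρ : ℂ) * (1 - (ρ : ℂ)))))).re := by
  intro n s c hs
  have key : ∀ a b,
      (∑' ρ : ZetaZeros.riemannZetaNontrivialZeros,
          (riemannZetaZeroOrder (ρ : ℂ) : ℂ) * cexp (-(((s a + s b : ℝ) : ℂ) * ((ρ : ℂ) * (1 - (ρ : ℂ)))))).re =
        Real.exp (-(s a) / 4) * Real.exp (-(s b) / 4) *
          (weilFunctional (fun t : ℝ =>
            ((Real.exp (-(t ^ 2) / (4 * (s a + s b))) / Real.sqrt (4 * Real.pi * (s a + s b)) : ℝ) : ℂ))).re := by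
    intro a b
    rw [heatTrace_eq_gauss (s a + s b) (add_pos (hs a) (hs b)), ← Real.exp_add,
      show -((s a + s b : ℝ) : ℂ) / 4 = ((-(s a) / 4 + -(s b) / 4 : ℝ) : ℂ) by push_cast; ring,
      ← Complex.ofReal_exp, Complex.re_ofReal_mul]
  simp_rw [key]
  have h := hbet n s (fun a => c a * Real.exp (-(s a) / 4)) hs
  refine le_of_le_of_eq h (Finset.sum_congr rfl fun a _ => Finset.sum_congr rfl fun b _ => ?_)
  ring

/-- **Calibration / honesty: the prime-side bet is EXACTLY the crux** (unfolded): `stub_weilGaussPD ⟺ X`.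
`→`: `heatPD` + `stub_heatCone_iff` (p90503). `←`: X ⟹ heat-cone positivity (p87151) and
`Re W(g_u) = e^{u/4} Re Z(u)` reverses the change of coefficients. -/
theorem weilGaussPD_iff_exactFirstBand :
    (∀ (n : ℕ) (s c : Fin n → ℝ), (∀ a, 0 < s a) →
      0 ≤ ∑ a, ∑ b, c a * c b *
        (weilFunctional (fun t : ℝ =>
          ((Real.exp (-(t ^ 2) / (4 * (s a + s b))) / Real.sqrt (4 * Real.pi * (s a + s b)) : ℝ) : ℂ))).re) ↔
    (∀ s : ℂ, riemannZeta s = 0 → 0 < s.re → s.re < 1 → s.re = 1 / 2 ∨ s.im = 0) := by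
  constructor
  · intro h
    exact stub_heatCone_iff.1 (heatPD_of_weilGaussPD h)
  · intro hX n s c hs
    have hPD := stub_exact_heatPD stub_heatSummable hX n s (fun a => c a * Real.exp (s a / 4)) hs
    have key : ∀ a b,
        (weilFunctional (fun t : ℝ =>
            ((Real.exp (-(t ^ 2) / (4 * (s a + s b))) / Real.sqrt (4 * Real.pi * (s a + s b)) : ℝ) : ℂ))).re =
          Real.exp (s a / 4) * Real.exp (s b / 4) *
            (∑' ρ : ZetaZeros.riemannZetaNontrivialZeros,
              (riemannZetaZeroOrder (ρ : ℂ) : ℂ) *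
                cexp (-(((s a + s b : ℝ) : ℂ) * ((ρ : ℂ) * (1 - (ρ : ℂ)))))).re := by
      intro a b
      rw [heatTrace_eq_gauss (s a + s b) (add_pos (hs a) (hs b)), ← Real.exp_add,
        show -((s a + s b : ℝ) : ℂ) / 4 = ((-(s a) / 4 + -(s b) / 4 : ℝ) : ℂ) by push_cast; ring,
        ← Complex.ofReal_exp, Complex.re_ofReal_mul, ← mul_assoc, ← Real.exp_add,
        show s a / 4 + s b / 4 + (-(s a) / 4 + -(s b) / 4) = 0 by ring, Real.exp_zero, one_mul]
    simp_rw [key]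
    refine le_of_le_of_eq hPD (Finset.sum_congr rfl fun a _ => Finset.sum_congr rfl fun b _ => ?_)
    ring


/-- The explicit formula for rapidly decaying smooth tests in the tree's symmetric-limit spelling
`HasWeilZeroSide g (weilFunctional g)` (cf. `explicit_formula_holds` for compactly supported `g`). -/
theorem hasWeilZeroSide_of_decay {g : ℝ → ℂ} (hg : ContDiff ℝ ∞ g)
    (h0 : Integrable (fun t : ℝ => ‖g t‖ * Real.exp (|t| / 2)))
    (h1 : Integrable (fun t : ℝ => ‖deriv g t‖ * Real.exp (|t| / 2)))
    (h2 : Integrable (fun t : ℝ => ‖deriv (deriv g) t‖ * Real.exp (|t| / 2)))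
    (hdec : ∃ C : ℝ, ∀ t : ℝ, ‖g t‖ ≤ C * Real.exp (-|t|)) :
    HasWeilZeroSide g (weilFunctional g) := by
  obtain ⟨hsum, hEF⟩ := explicit_formula_of_decay hg h0 h1 h2 hdec
  rw [← hEF]
  exact hasWeilZeroSide_tsum hsum

/-- **The prime-side bet is RH** (X ⟺ RH in tree, `Negative.exactFirstBand_iff_riemannHypothesis`). -/
theorem weilGaussPD_iff_riemannHypothesis :
    (∀ (n : ℕ) (s c : Fin n → ℝ), (∀ a, 0 < s a) →
      0 ≤ ∑ a, ∑ b, c a * c b *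
        (weilFunctional (fun t : ℝ =>
          ((Real.exp (-(t ^ 2) / (4 * (s a + s b))) / Real.sqrt (4 * Real.pi * (s a + s b)) : ℝ) : ℂ))).re) ↔
    RiemannHypothesis :=
  weilGaussPD_iff_exactFirstBand.trans Summit.RiemannHypothesis.Cruxes.ExactFirstBand.Negative.exactFirstBand_iff_riemannHypothesis

/-- **Weil positivity implies the prime-side bet** (through RH: `weil_criterion_holds`). -/
theorem weilGaussPD_of_weilPositivity (hW : WeilPositivity) :
    ∀ (n : ℕ) (s c : Fin n → ℝ), (∀ a, 0 < s a) →
      0 ≤ ∑ a, ∑ b, c a * c b *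
        (weilFunctional (fun t : ℝ =>
          ((Real.exp (-(t ^ 2) / (4 * (s a + s b))) / Real.sqrt (4 * Real.pi * (s a + s b)) : ℝ) : ℂ))).re :=
  weilGaussPD_iff_riemannHypothesis.2 ((weil_criterion_holds : RiemannHypothesis ↔ WeilPositivity).2 hW)

end Summit.RiemannHypothesis.RiemannHypothesis.Theorems.RuelleBandExactFirstBand

end
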